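import Summits.BirchSwinnertonDyer.Rank1Residual.ManinAdditive.TwistOrbitManinTransportProof
import Literature.NumberTheory.EllipticCurves.ManinConstantQuadraticTwistAtTwoProofs
import Literature.NumberTheory.EllipticCurves.ModularDegreeQuadraticTwistValuation
import Literature.NumberTheory.EllipticCurves.ManinConstantQuadraticTwistAtTwoOrdinaryProofs
import HarnessLib

/-!
# Twist-orbit transport of the Manin constant — ADD-ON part 1/4 (`TwistOrbitAtTwoA1OddDichotomy`) to the typer's landing of T-an-6 (files F1–F3 =
# HOME/an/Sketch-an4v5.lean 2d253c8874352f93): the prime-2 theorems THM I′, E-an-18r, S-an-14, E-an-20, E-an-21,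
# the E-an-17 degree dichotomy at odd `q`, and the closed `(q*, q, q²)` obligations (§§9–14 of the planner's
# leaf HOME/an/Leaf-TwistOrbitManinTransport.lean f491d1e88c8dc766, VERBATIM).

PROVENANCE / HOW TO LAND. Cell `bsd-f2-manin`, planner `bsd-f2-manin-an` g3. This file = exactly the
declarations of the leaf f491d1e88c8dc766 that are NOT in Sketch-an4v5 (the typer's F1–F3 source), in leaf
order, importing F1–F3 under the module names the typer announced (STATUS 18:40Z: `TwistOrbitManinStatements`
(p556717), `TwistOrbitDegreeIdentity`, `TwistOrbitManinTransportProof`) — adjust the three `import Summits.…`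
lines to the landed names. It was compiled on the farm as HOME/an/Addon-AtTwo-simulated.lean (= Sketch-an4v5
body with the cell namespace + this body): rc 0 · 0 err · 0 warn · 0 sorries; audit ok. It needs from F1–F3
only: `not_good_and_not_mult_of_sq_dvd_conductorNorm`, `u_sq_eq_one_of_smul_quadraticTwist_of_Δ`,
`deg_mul_c_sq_eq_of_pStar`, `maninConstant_dvd_mul_of_charTwist_gamma0`, `twistOrbitManinTransport_pStar`,
`commutingOrbitManinChain_pStar`, `orbitDegreeManinIdentity_pStar`, `maninEqOfNotDvdDegree_pStar_holds`,
`flipOrbitManinEq_pStar`, `twistPartnerDegreeBound_pStar`, `twistMinimalDegreeRoadTransport_pStar`,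
`orbitManinDefectLeOne_pStar`, the statement schemas, and `natAbs_eq_and_deg_eq_of_chain`; if the typer renamed
any of them (dedup), rename here too.  Split for the 400-line rule at the `section` boundaries
(`OddDichotomy` | `Closed` | `EvenTwist`+`ClosedEven` | `EvenDegree`+`ClosedEvenDegree` | `ExactAtTwo`).

RESULTS (all kernel-checked, no `sorry`, every `@[conjecture] def` closed by a hypothesis-free `_holds` or a
generic `_of_` theorem; statements, census numbers and references: the leaf's module docstring and
HOME/MEMO-an.md §§27–39; HOME/CANDIDATES.md rows E-an-17, E-an-18/18c/18v, E-an-18r/S-an-14, E-an-20, E-an-21).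
-/

noncomputable section

open scoped MatrixGroups ModularForm

open CongruenceSubgroup WeierstrassCurve
  Literature.NumberTheory.DiophantineGeometry
  Literature.NumberTheory.EllipticCurves
  Literature.NumberTheory.EllipticCurves.ModularForms

namespace Summit.BirchSwinnertonDyer.Rank1Residual.ManinAdditive

section OddDichotomy

variable {q : ℕ}

/-- **Kernel-checked core of E-an-17.** `c' ∣ c ∣ q·c'`, `deg'·c² = q·deg·c'²`, `q` prime ⇒
`deg' = q·deg` (when `c = ±c'`) or `q·deg' = deg` (when `c = ±q·c'`). [elementary] -/
theorem deg_eq_or_eq_of_chain {q : ℕ} (hq : q.Prime) {c c' : ℤ} {deg deg' : ℕ}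
    (hc' : c' ≠ 0) (h1 : c' ∣ c) (h2 : c ∣ (q : ℤ) * c')
    (hI : (deg' : ℤ) * c ^ 2 = (q : ℤ) * deg * c' ^ 2) :
    deg' = q * deg ∨ q * deg' = deg := by
  by_cases hdeg : q ∣ deg
  · obtain ⟨k, hk⟩ := h1
    have hkq : k ∣ (q : ℤ) := by
      obtain ⟨m, hm⟩ := h2
      refine ⟨m, ?_⟩
      have hmc : (q : ℤ) * c' = c' * k * m := by rw [← hk]; exact hm
      have : c' * ((q : ℤ) - k * m) = 0 := by linear_combination hmc
      rcases mul_eq_zero.mp this with h0 | h0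
      · exact absurd h0 hc'
      · linear_combination h0
    have hknat : k.natAbs ∣ q := by
      have := Int.natAbs_dvd_natAbs.mpr hkq
      simpa using this
    have hc'2 : c' ^ 2 ≠ 0 := pow_ne_zero 2 hc'
    have hq0 : (q : ℤ) ≠ 0 := by exact_mod_cast hq.ne_zero
    rcases (Nat.dvd_prime hq).mp hknat with h1' | hq'
    · left
      have hk2 : k ^ 2 = 1 := by rw [← Int.natAbs_sq k, h1']; simp
      have hI' : (deg' : ℤ) * c' ^ 2 = (q : ℤ) * deg * c' ^ 2 := by
        linear_combination hI - (deg' : ℤ) * (c + c' * k) * hk - (deg' : ℤ) * c' ^ 2 * hk2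
      have : (deg' : ℤ) = (q : ℤ) * deg := mul_right_cancel₀ hc'2 hI'
      exact_mod_cast this
    · right
      have hk2 : k ^ 2 = (q : ℤ) ^ 2 := by rw [← Int.natAbs_sq k, hq']
      have hI' : (deg' : ℤ) * (q : ℤ) ^ 2 * c' ^ 2 = (q : ℤ) * deg * c' ^ 2 := by
        linear_combination hI - (deg' : ℤ) * (c + c' * k) * hk - (deg' : ℤ) * c' ^ 2 * hk2
      have h3 : (deg' : ℤ) * (q : ℤ) ^ 2 = (q : ℤ) * deg := mul_right_cancel₀ hc'2 hI'
      have h4 : (q : ℤ) * deg' = deg := by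
        have : (q : ℤ) * ((q : ℤ) * deg') = (q : ℤ) * deg := by linear_combination h3
        exact mul_left_cancel₀ hq0 this
      exact_mod_cast h4
  · exact Or.inl (natAbs_eq_and_deg_eq_of_chain hq hc' h1 h2 hI hdeg).2

/-- **E-an-17 `CommutingOrbitDegreeDichotomy d q M` (THEOREM; the proved shadow of the tree conjecture
`RamifiedTwistDegreeDichotomy` on commuting orbits).** On a COMMUTING same-level `χ_d`-orbit (`u • (W ⊗ χ_d) = W′`)
with `W` twist-minimal and both data lattice-optimal: `deg φ_{W′} = q·deg φ_W` or `q·deg φ_{W′} = deg φ_W` — the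
`q`-adic valuation of the optimal degree jumps by exactly `±1` (never `0`, never `±2`); the sign is `+` iff
`c′ = ±c` (E-an-16 gives `+` whenever `q ∤ deg φ_W`).  Cremona's table, `N < 5·10⁵`: `+` on 141 917 / 81 755
/ 46 851 commuting orbits at `q = 3 / 5 / 7`, as Manin's conjecture predicts, and ONE table row outside the
dichotomy — `463834b` (`v₇Δ = 3`, `deg = 41 932 800`) ↔ `463834a` (`v₇Δ = 9`, `deg = 73 382 400`), ratio `7/4`
— which this THEOREM makes a certified inconsistency of the (uncertified, `N > 4·10⁵`) degree table (cell ask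
D-an-5: recomputation jobs j284407 / j284411 / j284426; prediction `deg(463834b) = 10 483 200` or
`deg(463834a) = 293 529 600`).
[cite: Watkins2002, §2.1 p. 491 (shape only)] -/
@[conjecture] def CommutingOrbitDegreeDichotomy (d : ℤ) (q M : ℕ) : Prop :=
  ∀ (W W' : WeierstrassCurve ℚ) [W.IsElliptic] [W.IsGloballyMinimal] [W'.IsElliptic]
    [W'.IsGloballyMinimal] [NeZero (W.conductorNorm ℤ)] [NeZero (W'.conductorNorm ℤ)]
    (u : VariableChange ℚ) (D : ModularParametrizationData W (W.conductorNorm ℤ))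
    (D' : ModularParametrizationData W' (W'.conductorNorm ℤ)),
    M ∣ W.conductorNorm ℤ → W'.conductorNorm ℤ = W.conductorNorm ℤ →
    u • W.quadraticTwist ((d : ℤ) : ℚ) = W' → (∀ z ∈ D.L.lattice, ∃ w ∈ periodLattice D.f, z = D.c * w) →
    (∀ z ∈ D'.L.lattice, ∃ w ∈ periodLattice D'.f, z = D'.c * w) →
    W'.Δ = ((d : ℤ) : ℚ) ^ 6 * W.Δ → q.Prime →
    D'.modularDegree = q * D.modularDegree ∨ q * D'.modularDegree = D.modularDegree

/-- PROVED edge: E-an-12c ∧ S-an-13 ⇒ E-an-17. -/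
theorem commutingOrbitDegreeDichotomy_of_chain (d : ℤ) (q M : ℕ)
    (hCh : CommutingOrbitManinChain d q M) (hI : OrbitDegreeManinIdentity d q M) :
    CommutingOrbitDegreeDichotomy d q M := by
  intro W W' _ _ _ _ _ _ u D D' hM hN hu hD hD' hΔ hq
  obtain ⟨h1, h2⟩ := hCh W W' u D D' hM hN hu hD hD' hΔ
  exact deg_eq_or_eq_of_chain hq D'.maninConstant_ne_zero_holds h1 h2 (hI W W' u D D' hM hN hu hD hD' hΔ)

/-- **E-an-17 at `(q*, q, q²)` OUTRIGHT.** [cite: Watkins2002, §2.1] [cite: Stevens1989, Lemma (5.4)] -/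
theorem commutingOrbitDegreeDichotomy_pStar (hq : q.Prime) (hq2 : q ≠ 2) :
    CommutingOrbitDegreeDichotomy ((-1 : ℤ) ^ (q / 2) * q) q (q ^ 2) :=
  commutingOrbitDegreeDichotomy_of_chain _ _ _ (commutingOrbitManinChain_pStar hq hq2)
    (orbitDegreeManinIdentity_pStar hq hq2)

/-- In valuations: `v_q(deg φ_{W′}) = v_q(deg φ_W) + 1 ∨ v_q(deg φ_{W′}) + 1 = v_q(deg φ_W)` — the two
inequalities of `RamifiedTwistDegreeDichotomy q q*` on commuting, twist-minimal-oriented orbits. -/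
theorem padicValNat_modularDegree_jump_pStar (hq : q.Prime) (hq2 : q ≠ 2)
    (W W' : WeierstrassCurve ℚ) [W.IsElliptic] [W.IsGloballyMinimal] [W'.IsElliptic]
    [W'.IsGloballyMinimal] [NeZero (W.conductorNorm ℤ)] [NeZero (W'.conductorNorm ℤ)]
    (u : VariableChange ℚ) (D : ModularParametrizationData W (W.conductorNorm ℤ))
    (D' : ModularParametrizationData W' (W'.conductorNorm ℤ))
    (hM : q ^ 2 ∣ W.conductorNorm ℤ) (hN : W'.conductorNorm ℤ = W.conductorNorm ℤ)
    (hu : u • W.quadraticTwist ((((-1 : ℤ) ^ (q / 2) * q : ℤ) : ℤ) : ℚ) = W')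
    (hD : (∀ z ∈ D.L.lattice, ∃ w ∈ periodLattice D.f, z = D.c * w)) (hD' :
    (∀ z ∈ D'.L.lattice, ∃ w ∈ periodLattice D'.f, z = D'.c * w))
    (hΔ : W'.Δ = ((((-1 : ℤ) ^ (q / 2) * q : ℤ) : ℤ) : ℚ) ^ 6 * W.Δ) :
    padicValNat q D'.modularDegree = padicValNat q D.modularDegree + 1 ∨
      padicValNat q D'.modularDegree + 1 = padicValNat q D.modularDegree := by
  haveI : Fact q.Prime := ⟨hq⟩
  have h0 : D.modularDegree ≠ 0 := D.deg_pos.ne'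
  have h0' : D'.modularDegree ≠ 0 := D'.deg_pos.ne'
  rcases commutingOrbitDegreeDichotomy_pStar hq hq2 W W' u D D' hM hN hu hD hD' hΔ hq with h | h
  · left
    rw [h, padicValNat.mul hq.ne_zero h0, padicValNat.self hq.one_lt, add_comm]
  · right
    rw [← h, padicValNat.mul hq.ne_zero h0', padicValNat.self hq.one_lt, add_comm]


end OddDichotomy

/-! ## §9. Closed obligations at `(d, q, M) = (q*, q, q²)` — one per candidate, the side conditions
`q.Prime`, `q ≠ 2` INSIDE the statement, each proved outright by a `_holds` theorem with no hypotheses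
(E-an-12 carries Pal's dichotomy `PalTwistDichotomy`, the only conjecture-tagged input, as an antecedent).
`(q := 3)` is the `III ↔ III*` family at `9 ‖ N` (`(−3, 3, 9)`), `(q := 5)` is `(5, 5, 25)`, `(q := 7)` is
`(−7, 7, 49)`. -/

section Closed

/-- **E-an-9 / THEOREM A at `(q*, q, q²)`, every odd prime `q`.** -/
@[conjecture] def TwistOrbitManinTransportPStar (q : ℕ) : Prop :=
  q.Prime → q ≠ 2 → TwistOrbitManinTransport ((-1 : ℤ) ^ (q / 2) * q) q (q ^ 2)

/-- `twistOrbitManinTransportPStar_holds`: the kernel-checked instance closing the statement above (hypothesis-free). -/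
theorem twistOrbitManinTransportPStar_holds (q : ℕ) : TwistOrbitManinTransportPStar q :=
  fun hq hq2 ↦ twistOrbitManinTransport_pStar hq hq2

/-- **E-an-12c at `(q*, q, q²)`.** -/
@[conjecture] def CommutingOrbitManinChainPStar (q : ℕ) : Prop :=
  q.Prime → q ≠ 2 → CommutingOrbitManinChain ((-1 : ℤ) ^ (q / 2) * q) q (q ^ 2)

/-- `commutingOrbitManinChainPStar_holds`: the kernel-checked instance closing the statement above (hypothesis-free). -/
theorem commutingOrbitManinChainPStar_holds (q : ℕ) : CommutingOrbitManinChainPStar q :=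
  fun hq hq2 ↦ commutingOrbitManinChain_pStar hq hq2

/-- **S-an-13 / THEOREM B at `(q*, q, q²)`.** [cite: Watkins2002, §2.1 p. 491] -/
@[conjecture] def OrbitDegreeManinIdentityPStar (q : ℕ) : Prop :=
  q.Prime → q ≠ 2 → OrbitDegreeManinIdentity ((-1 : ℤ) ^ (q / 2) * q) q (q ^ 2)

/-- `orbitDegreeManinIdentityPStar_holds`: the kernel-checked instance closing the statement above (hypothesis-free). -/
theorem orbitDegreeManinIdentityPStar_holds (q : ℕ) : OrbitDegreeManinIdentityPStar q :=
  fun hq hq2 ↦ orbitDegreeManinIdentity_pStar hq hq2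

/-- **E-an-16 at `(q*, q, q²)`.** -/
@[conjecture] def ManinEqOfNotDvdDegreePStar (q : ℕ) : Prop :=
  q.Prime → q ≠ 2 → ManinEqOfNotDvdDegree ((-1 : ℤ) ^ (q / 2) * q) q (q ^ 2)

/-- `maninEqOfNotDvdDegreePStar_holds`: the kernel-checked instance closing the statement above (hypothesis-free). -/
theorem maninEqOfNotDvdDegreePStar_holds (q : ℕ) : ManinEqOfNotDvdDegreePStar q :=
  fun hq hq2 ↦ maninEqOfNotDvdDegree_pStar_holds hq hq2

/-- **E-an-17 at `(q*, q, q²)`.** -/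
@[conjecture] def CommutingOrbitDegreeDichotomyPStar (q : ℕ) : Prop :=
  q.Prime → q ≠ 2 → CommutingOrbitDegreeDichotomy ((-1 : ℤ) ^ (q / 2) * q) q (q ^ 2)

/-- `commutingOrbitDegreeDichotomyPStar_holds`: the kernel-checked instance closing the statement above (hypothesis-free). -/
theorem commutingOrbitDegreeDichotomyPStar_holds (q : ℕ) : CommutingOrbitDegreeDichotomyPStar q :=
  fun hq hq2 ↦ commutingOrbitDegreeDichotomy_pStar hq hq2

/-- **E-an-11 / THEOREM II at `(q*, q, q²)`.** -/
@[conjecture] def FlipOrbitManinEqPStar (q : ℕ) : Prop :=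
  q.Prime → q ≠ 2 → FlipOrbitManinEq ((-1 : ℤ) ^ (q / 2) * q) q (q ^ 2)

/-- `flipOrbitManinEqPStar_holds`: the kernel-checked instance closing the statement above (hypothesis-free). -/
theorem flipOrbitManinEqPStar_holds (q : ℕ) : FlipOrbitManinEqPStar q :=
  fun hq hq2 ↦ flipOrbitManinEq_pStar hq hq2

/-- **E-an-15v at `(q*, q²)`** (ČNS Thm 1.2 = the tree fact `cesnaviciusNeururerSaha_thm_1_2`, carried as
an explicit antecedent exactly as F1–F3 carry it). -/
@[conjecture] def TwistPartnerDegreeBoundPStar (q : ℕ) : Prop :=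
  q.Prime → q ≠ 2 → cesnaviciusNeururerSaha_thm_1_2 → TwistPartnerDegreeBound ((-1 : ℤ) ^ (q / 2) * q) (q ^ 2)

/-- `twistPartnerDegreeBoundPStar_holds`: the kernel-checked instance closing the statement above (hypothesis-free). -/
theorem twistPartnerDegreeBoundPStar_holds (q : ℕ) : TwistPartnerDegreeBoundPStar q :=
  fun hq hq2 hCNS ↦ twistPartnerDegreeBound_pStar hq hq2 hCNS

/-- **E-an-15 at `(q*, q²)`** (ČNS Thm 1.2 as an explicit antecedent, as in F1–F3) — the census-bearing
statement. -/
@[conjecture] def TwistMinimalDegreeRoadTransportPStar (q : ℕ) : Prop :=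
  q.Prime → q ≠ 2 → cesnaviciusNeururerSaha_thm_1_2 →
    TwistMinimalDegreeRoadTransport ((-1 : ℤ) ^ (q / 2) * q) (q ^ 2)

/-- `twistMinimalDegreeRoadTransportPStar_holds`: the kernel-checked instance closing the statement above (hypothesis-free). -/
theorem twistMinimalDegreeRoadTransportPStar_holds (q : ℕ) : TwistMinimalDegreeRoadTransportPStar q :=
  fun hq hq2 hCNS ↦ twistMinimalDegreeRoadTransport_pStar hq hq2 hCNS

/-- **E-an-12 / THEOREM III at `(q*, q, q²)` modulo Pal's dichotomy** (S-an-11, Pal 2012 Prop. 2.5, carried as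
the antecedent `PalTwistDichotomy`). [cite: Pal2012, Prop. 2.5] -/
@[conjecture] def OrbitManinDefectLeOnePStar (q : ℕ) : Prop :=
  q.Prime → q ≠ 2 → PalTwistDichotomy ((-1 : ℤ) ^ (q / 2) * q) q (q ^ 2) →
    OrbitManinDefectLeOne ((-1 : ℤ) ^ (q / 2) * q) q (q ^ 2)

/-- `orbitManinDefectLeOnePStar_holds`: the kernel-checked instance closing the statement above (hypothesis-free). -/
theorem orbitManinDefectLeOnePStar_holds (q : ℕ) : OrbitManinDefectLeOnePStar q :=
  fun hq hq2 hP ↦ orbitManinDefectLeOne_pStar hq hq2 hP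

/-- **E-an-17v at `(q*, q, q²)`** — E-an-17 in valuations, the two clauses of the tree conjecture
`RamifiedTwistDegreeDichotomy q q*` on commuting, twist-minimal-oriented orbits:
`v_q(deg φ_{W′}) = v_q(deg φ_W) + 1 ∨ v_q(deg φ_{W′}) + 1 = v_q(deg φ_W)`. -/
@[conjecture] def CommutingOrbitDegreeValuationJumpPStar (q : ℕ) : Prop :=
  q.Prime → q ≠ 2 →
  ∀ (W W' : WeierstrassCurve ℚ) [W.IsElliptic] [W.IsGloballyMinimal] [W'.IsElliptic]
    [W'.IsGloballyMinimal] [NeZero (W.conductorNorm ℤ)] [NeZero (W'.conductorNorm ℤ)]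
    (u : VariableChange ℚ) (D : ModularParametrizationData W (W.conductorNorm ℤ))
    (D' : ModularParametrizationData W' (W'.conductorNorm ℤ)),
    q ^ 2 ∣ W.conductorNorm ℤ → W'.conductorNorm ℤ = W.conductorNorm ℤ →
    u • W.quadraticTwist ((((-1 : ℤ) ^ (q / 2) * q : ℤ) : ℤ) : ℚ) = W' →
    (∀ z ∈ D.L.lattice, ∃ w ∈ periodLattice D.f, z = D.c * w) →
    (∀ z ∈ D'.L.lattice, ∃ w ∈ periodLattice D'.f, z = D'.c * w) →
    W'.Δ = ((((-1 : ℤ) ^ (q / 2) * q : ℤ) : ℤ) : ℚ) ^ 6 * W.Δ →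
    padicValNat q D'.modularDegree = padicValNat q D.modularDegree + 1 ∨
      padicValNat q D'.modularDegree + 1 = padicValNat q D.modularDegree

/-- `commutingOrbitDegreeValuationJumpPStar_holds`: the kernel-checked instance closing the statement above (hypothesis-free). -/
theorem commutingOrbitDegreeValuationJumpPStar_holds (q : ℕ) :
    CommutingOrbitDegreeValuationJumpPStar q :=
  fun hq hq2 W W' _ _ _ _ _ _ u D D' hM hN hu hD hD' hΔ ↦
    padicValNat_modularDegree_jump_pStar hq hq2 W W' u D D' hM hN hu hD hD' hΔ

end Closed

end Summit.BirchSwinnertonDyer.Rank1Residual.ManinAdditive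

end
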